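import Mathlib.Algebra.MvPolynomial.PDeriv
import Mathlib.Algebra.MvPolynomial.CommRing
import Mathlib.RingTheory.MvPolynomial.Basic
import Mathlib.Algebra.CharP.Lemmas
import Mathlib.Algebra.CharP.Two
import Mathlib.Data.ZMod.Basic
import Mathlib.Tactic.Ring
import Mathlib.Tactic.LinearCombination
import Mathlib.Tactic.ReduceModChar
import Mathlib.Tactic.FinCases
import HarnessLib

/-!
# K4.2 kill-test certificates (rung L, slot W4.2: Hilbert–Samuel / CJS home) — the two registered specimens

Kernel-checked polynomial identities used by the kill test K4.2 of the cell `res-hironaka`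
(seat `res-L0-k42`; pre-registration on the cell STATUS 2026-08-26T16:33:40Z). Everything here is
OURS (campaign objects re-derived for the test); nothing is a statement of, or attributed to, the
manuscript under review. The specimens:

* **W1** = the plane cusp `y² + x⁵` in characteristic `2` (prior witness "R10"): the two point
  blow-ups `y² + x⁵ ↦ y² + x³ ↦ y² + x` of the Hilbert–Samuel-maximal point, as chart identities
  over any commutative ring (`cusp_chart₁`, `cusp_chart₂`), ending at a polynomial with a unit
  partial derivative (`cusp_resolved_pderiv`).
* **W2** = the "W-Q" fourfold `f = x² + wv⁶ + zw⁵v² + yz²wv⁴ + yz³w⁵ + yz⁹ + y⁴zw²v² + y¹¹ ⊂ 𝔸⁵`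
  in characteristic `2` (prior family "R18", variables `0,1,2,3,4 = x,y,z,w,v`): (i) the curve
  `γ(t) = (t⁹⁹, t¹⁸, t²⁰, t²⁴, t²⁹)` lies on `V(f, ∂f/∂y, ∂f/∂z, ∂f/∂w)` and `∂f/∂x = ∂f/∂v = 0`
  (`aeval_gamma_fWQ`, `pderiv_fWQ_*`, `aeval_gamma_pderiv_*`), i.e. `γ ⊆ Sing X = X(ν̃)` (for a
  hypersurface the Hilbert–Samuel stratum is the multiplicity stratum, and `f − x²` does not involve
  `x`, so the multiplicity is `≤ 2` everywhere: `fWQ_eq_sq_add`); (ii) the blow-up of the origin: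
  in the `y`-chart the total transform is `y² · (x² + y⁵ · G₁)` (`fWQ_chartY`) — the exceptional
  divisor meets the strict transform in the double hyperplane `x² = 0`, so every near point has
  `x = 0`, i.e. lies in `ℙ(Dir)` for the directrix ideal `⟨X⟩` of the initial form `x²` — and in
  the `x`-chart it is `x² · (1 + x⁵ · H₁)` (`fWQ_chartX`), a unit along the exceptional divisor
  (`eval_strictX_eq_one`): no point of the strict transform lies over the origin in that chart.

These identities are the in-Lean half of the test; the walk itself (CJS LNM 2270 Rem. 6.29) is the
kit job cited in `L/res-L0-k42/KILL-TEST-K4.2.md` of the cell. AI-produced; weaker than expert review.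
-/

set_option linter.dupNamespace false -- mandated namespace of this single-conjunct summit

namespace Summit.ResolutionOfSingularities.ResolutionOfSingularities.Theorems.K42

open MvPolynomial

noncomputable section

section Cusp

variable (R : Type*) [CommRing R]

/-- W1, the plane cusp `y² + x⁵` (variables `0 = x`, `1 = y`). OURS (test specimen). -/
def cusp : MvPolynomial (Fin 2) R := X 1 ^ 2 + X 0 ^ 5

/-- After one point blow-up (x-chart): `y² + x³`. OURS. -/
def cusp₁ : MvPolynomial (Fin 2) R := X 1 ^ 2 + X 0 ^ 3

/-- After two point blow-ups: `y² + x`. OURS. -/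
def cusp₂ : MvPolynomial (Fin 2) R := X 1 ^ 2 + X 0

/-- The `x`-chart of the blow-up of the origin of the plane: `x ↦ x`, `y ↦ x·y`. [folklore] -/
def planeChartX : Fin 2 → MvPolynomial (Fin 2) R := ![X 0, X 0 * X 1]

/-- First blow-up of the cusp, `x`-chart: total transform `= x² · (y² + x³)` (multiplicity `2` at the
origin, strict transform `cusp₁`). [folklore] -/
theorem cusp_chart₁ : aeval (planeChartX R) (cusp R) = X 0 ^ 2 * cusp₁ R := by
  simp only [cusp, cusp₁, planeChartX, map_add, map_pow, aeval_X, Matrix.cons_val_zero,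
    Matrix.cons_val_one]
  ring

/-- Second blow-up, `x`-chart: total transform of `cusp₁` `= x² · (y² + x)`. [folklore] -/
theorem cusp_chart₂ : aeval (planeChartX R) (cusp₁ R) = X 0 ^ 2 * cusp₂ R := by
  simp only [cusp₁, cusp₂, planeChartX, map_add, map_pow, aeval_X, Matrix.cons_val_zero,
    Matrix.cons_val_one]
  ring

/-- `cusp₂ = y² + x` has `∂/∂x = 1`: a unit, so `V(cusp₂)` has no point of multiplicity `≥ 2`
(the Hilbert–Samuel-maximal value of the cusp is eliminated after two point blow-ups). [folklore] -/
theorem cusp_resolved_pderiv : pderiv 0 (cusp₂ R) = 1 := by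
  simp [cusp₂, Derivation.leibniz_pow]

end Cusp

section WQ

variable (R : Type*) [CommRing R]

/-- W2, the W-Q fourfold equation `x² + wv⁶ + zw⁵v² + yz²wv⁴ + yz³w⁵ + yz⁹ + y⁴zw²v² + y¹¹`
(variables `0,1,2,3,4 = x,y,z,w,v`; quasi-homogeneous of degree `198` for the weights
`(99,18,20,24,29)`). OURS (campaign test specimen; not a statement of the manuscript). -/
def fWQ : MvPolynomial (Fin 5) R :=
  X 0 ^ 2 + X 3 * X 4 ^ 6 + X 2 * X 3 ^ 5 * X 4 ^ 2 + X 1 * X 2 ^ 2 * X 3 * X 4 ^ 4 +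
    X 1 * X 2 ^ 3 * X 3 ^ 5 + X 1 * X 2 ^ 9 + X 1 ^ 4 * X 2 * X 3 ^ 2 * X 4 ^ 2 + X 1 ^ 11

/-- `f − x²`, which does not involve the variable `x`. OURS. -/
def gWQ : MvPolynomial (Fin 5) R :=
  X 3 * X 4 ^ 6 + X 2 * X 3 ^ 5 * X 4 ^ 2 + X 1 * X 2 ^ 2 * X 3 * X 4 ^ 4 +
    X 1 * X 2 ^ 3 * X 3 ^ 5 + X 1 * X 2 ^ 9 + X 1 ^ 4 * X 2 * X 3 ^ 2 * X 4 ^ 2 + X 1 ^ 11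

/-- `f = x² + g` with `g` free of `x`: the shape `x^p + F` (purely inseparable double cover), so
the multiplicity of `f` is `≤ 2` at every point and `X(ν̃) = Sing X`. OURS. -/
theorem fWQ_eq_sq_add : fWQ R = X 0 ^ 2 + gWQ R := by
  simp only [fWQ, gWQ]; ring

/-- The reduction mod `2` of `∂f/∂y`: `z²wv⁴ + z³w⁵ + z⁹ + y¹⁰`. OURS. -/
def fWQy : MvPolynomial (Fin 5) R := X 2 ^ 2 * X 3 * X 4 ^ 4 + X 2 ^ 3 * X 3 ^ 5 + X 2 ^ 9 + X 1 ^ 10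

/-- The reduction mod `2` of `∂f/∂z`: `w⁵v² + yz²w⁵ + yz⁸ + y⁴w²v²`. OURS. -/
def fWQz : MvPolynomial (Fin 5) R :=
  X 3 ^ 5 * X 4 ^ 2 + X 1 * X 2 ^ 2 * X 3 ^ 5 + X 1 * X 2 ^ 8 + X 1 ^ 4 * X 3 ^ 2 * X 4 ^ 2

/-- The reduction mod `2` of `∂f/∂w`: `v⁶ + zw⁴v² + yz²v⁴ + yz³w⁴`. OURS. -/
def fWQw : MvPolynomial (Fin 5) R :=
  X 4 ^ 6 + X 2 * X 3 ^ 4 * X 4 ^ 2 + X 1 * X 2 ^ 2 * X 4 ^ 4 + X 1 * X 2 ^ 3 * X 3 ^ 4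

/-- The monomial curve `γ(t) = (t⁹⁹, t¹⁸, t²⁰, t²⁴, t²⁹)` carried by the W-Q family. OURS. -/
def gammaWQ : Fin 5 → Polynomial R := ![Polynomial.X ^ 99, Polynomial.X ^ 18, Polynomial.X ^ 20,
  Polynomial.X ^ 24, Polynomial.X ^ 29]

end WQ

section WQchar2

/-! Characteristic-`2` computations, stated over the prime field `ZMod 2` (they base-change to any
field of characteristic `2`). -/


/-- `2 = 0` in `𝔽₂[x,y,z,w,v]`. [folklore] -/
theorem two_eq_zero_mv : (2 : MvPolynomial (Fin 5) (ZMod 2)) = 0 := by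
  have h : (2 : ZMod 2) = 0 := by decide
  rw [← map_ofNat (C : ZMod 2 →+* MvPolynomial (Fin 5) (ZMod 2)) 2, h, map_zero]

/-- In characteristic `2`: `∂f/∂x = 0`. OURS. -/
theorem pderiv_fWQ_x : pderiv 0 (fWQ (ZMod 2)) = 0 := by
  simp [fWQ, Derivation.leibniz, Derivation.leibniz_pow, pderiv_X]
  linear_combination two_eq_zero_mv

/-- In characteristic `2`: `∂f/∂v = 0` (every exponent of `v` in `f` is even). OURS. -/
theorem pderiv_fWQ_v : pderiv 4 (fWQ (ZMod 2)) = 0 := by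
  simp [fWQ, Derivation.leibniz, Derivation.leibniz_pow, pderiv_X]
  linear_combination (2 * X 3 * X 4 ^ 3 * X 2 ^ 2 * X 1 + 3 * X 3 * X 4 ^ 5 + X 3 ^ 2 * X 4 * X 2 * X 1 ^ 4 +
    X 3 ^ 5 * X 4 * X 2) * two_eq_zero_mv

/-- In characteristic `2`: `∂f/∂y = z²wv⁴ + z³w⁵ + z⁹ + y¹⁰`. OURS. -/
theorem pderiv_fWQ_y : pderiv 1 (fWQ (ZMod 2)) = fWQy (ZMod 2) := by
  simp [fWQ, fWQy, Derivation.leibniz, Derivation.leibniz_pow, pderiv_X]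
  linear_combination (2 * X 4 ^ 2 * X 3 ^ 2 * X 2 * X 1 ^ 3 + 5 * X 1 ^ 10) * two_eq_zero_mv

/-- In characteristic `2`: `∂f/∂z = w⁵v² + yz²w⁵ + yz⁸ + y⁴w²v²`. OURS. -/
theorem pderiv_fWQ_z : pderiv 2 (fWQ (ZMod 2)) = fWQz (ZMod 2) := by
  simp [fWQ, fWQz, Derivation.leibniz, Derivation.leibniz_pow, pderiv_X]
  linear_combination (X 4 ^ 4 * X 3 * X 1 * X 2 + X 3 ^ 5 * X 1 * X 2 ^ 2 + 4 * X 1 * X 2 ^ 8) *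
    two_eq_zero_mv

/-- In characteristic `2`: `∂f/∂w = v⁶ + zw⁴v² + yz²v⁴ + yz³w⁴`. OURS. -/
theorem pderiv_fWQ_w : pderiv 3 (fWQ (ZMod 2)) = fWQw (ZMod 2) := by
  simp [fWQ, fWQw, Derivation.leibniz, Derivation.leibniz_pow, pderiv_X]
  linear_combination (X 4 ^ 2 * X 2 * X 3 * X 1 ^ 4 + 2 * X 4 ^ 2 * X 2 * X 3 ^ 4 +
    2 * X 2 ^ 3 * X 3 ^ 4 * X 1) * two_eq_zero_mv

/-- `γ ⊆ V(f)`: `f(γ(t)) = 8·t¹⁹⁸ = 0` in characteristic `2`. OURS. -/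
theorem aeval_gamma_fWQ : aeval (gammaWQ (ZMod 2)) (fWQ (ZMod 2)) = 0 := by
  simp only [fWQ, gammaWQ, map_add, map_mul, map_pow, aeval_X, Matrix.cons_val_zero,
    Matrix.cons_val_one, Matrix.cons_val]
  ring_nf
  reduce_mod_char

/-- `γ ⊆ V(∂f/∂y)`: `4·t¹⁸⁰ = 0`. OURS. -/
theorem aeval_gamma_pderiv_y : aeval (gammaWQ (ZMod 2)) (fWQy (ZMod 2)) = 0 := by
  simp only [fWQy, gammaWQ, map_add, map_mul, map_pow, aeval_X, Matrix.cons_val_zero,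
    Matrix.cons_val_one, Matrix.cons_val]
  ring_nf
  reduce_mod_char

/-- `γ ⊆ V(∂f/∂z)`: `4·t¹⁷⁸ = 0`. OURS. -/
theorem aeval_gamma_pderiv_z : aeval (gammaWQ (ZMod 2)) (fWQz (ZMod 2)) = 0 := by
  simp only [fWQz, gammaWQ, map_add, map_mul, map_pow, aeval_X, Matrix.cons_val_zero,
    Matrix.cons_val_one, Matrix.cons_val]
  ring_nf
  reduce_mod_char

/-- `γ ⊆ V(∂f/∂w)`: `4·t¹⁷⁴ = 0`. OURS. -/
theorem aeval_gamma_pderiv_w : aeval (gammaWQ (ZMod 2)) (fWQw (ZMod 2)) = 0 := by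
  simp only [fWQw, gammaWQ, map_add, map_mul, map_pow, aeval_X, Matrix.cons_val_zero,
    Matrix.cons_val_one, Matrix.cons_val]
  ring_nf
  reduce_mod_char

end WQchar2

section WQcharts

variable (R : Type*) [CommRing R]

/-- The `y`-chart of the blow-up of the origin of `𝔸⁵`: `x ↦ xy, y ↦ y, z ↦ zy, w ↦ wy, v ↦ vy`.
[folklore] -/
def chartY : Fin 5 → MvPolynomial (Fin 5) R := ![X 0 * X 1, X 1, X 2 * X 1, X 3 * X 1, X 4 * X 1]

/-- The `x`-chart of the blow-up of the origin of `𝔸⁵`: `x ↦ x, y ↦ yx, z ↦ zx, w ↦ wx, v ↦ vx`.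
[folklore] -/
def chartX : Fin 5 → MvPolynomial (Fin 5) R := ![X 0, X 1 * X 0, X 2 * X 0, X 3 * X 0, X 4 * X 0]

/-- `G₁ = wv⁶ + y(zw⁵v² + z²wv⁴) + y²(z³w⁵ + zw²v²) + y³z⁹ + y⁴`: the strict transform of the W-Q
fourfold in the `y`-chart is `x² + y⁵·G₁`. OURS. -/
def G₁ : MvPolynomial (Fin 5) R :=
  X 3 * X 4 ^ 6 + X 1 * (X 2 * X 3 ^ 5 * X 4 ^ 2 + X 2 ^ 2 * X 3 * X 4 ^ 4) +
    X 1 ^ 2 * (X 2 ^ 3 * X 3 ^ 5 + X 2 * X 3 ^ 2 * X 4 ^ 2) + X 1 ^ 3 * X 2 ^ 9 + X 1 ^ 4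

/-- `H₁ = wv⁶ + x(zw⁵v² + yz²wv⁴) + x²(yz³w⁵ + y⁴zw²v²) + x³yz⁹ + x⁴y¹¹`: the strict transform in
the `x`-chart is `1 + x⁵·H₁`. OURS. -/
def H₁ : MvPolynomial (Fin 5) R :=
  X 3 * X 4 ^ 6 + X 0 * (X 2 * X 3 ^ 5 * X 4 ^ 2 + X 1 * X 2 ^ 2 * X 3 * X 4 ^ 4) +
    X 0 ^ 2 * (X 1 * X 2 ^ 3 * X 3 ^ 5 + X 1 ^ 4 * X 2 * X 3 ^ 2 * X 4 ^ 2) +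
    X 0 ^ 3 * X 1 * X 2 ^ 9 + X 0 ^ 4 * X 1 ^ 11

/-- **Blow-up of the origin, `y`-chart.** Total transform `= y² · (x² + y⁵ G₁)`: multiplicity `2`
(the Hilbert–Samuel-maximal value) at the origin, and the strict transform meets the exceptional
divisor `{y = 0}` in `{x² = 0}` — every near point over the origin has `x = 0`, i.e. lies in
`ℙ(Dir)` for the directrix ideal `⟨X⟩` of the initial form `x²` (CJS Thm 3.14's conclusion holds at
this closed point with perfect residue field, as `DirectrixSmallCharacteristicNarrow` predicts). OURS. -/
theorem fWQ_chartY : aeval (chartY R) (fWQ R) = X 1 ^ 2 * (X 0 ^ 2 + X 1 ^ 5 * G₁ R) := by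
  simp only [fWQ, G₁, chartY, map_add, map_mul, map_pow, aeval_X, Matrix.cons_val_zero,
    Matrix.cons_val_one, Matrix.cons_val]
  ring

/-- **Blow-up of the origin, `x`-chart.** Total transform `= x² · (1 + x⁵ H₁)`. OURS. -/
theorem fWQ_chartX : aeval (chartX R) (fWQ R) = X 0 ^ 2 * (1 + X 0 ^ 5 * H₁ R) := by
  simp only [fWQ, H₁, chartX, map_add, map_mul, map_pow, aeval_X, Matrix.cons_val_zero,
    Matrix.cons_val_one, Matrix.cons_val]
  ring

/-- In the `x`-chart the strict transform `1 + x⁵H₁` takes the value `1` at every point of the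
exceptional divisor `{x = 0}`: no point of the blown-up fourfold lies over the origin in this chart
(all near points are in the other charts, inside `{x = 0} = ℙ(Dir)`). OURS. -/
theorem eval_strictX_eq_one (a : Fin 5 → R) (ha : a 0 = 0) :
    eval a (1 + X 0 ^ 5 * H₁ R) = 1 := by
  simp [H₁, ha]

end WQcharts

end

end Summit.ResolutionOfSingularities.ResolutionOfSingularities.Theorems.K42
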